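import Mathlib
import HarnessLib
import Literature.MathematicalPhysics.StatisticalMechanics.MuGSC
import Literature.Geometry.DiscreteGeometry.KissingPatterns
import Summits.AtomisticToContinuum.Statement

/-!
# Patch transport of robustly clean sites (route OverbindingBudget, crux `RobustDefectLimitWindows`,
item stmt-AtomisticToContinuum-31280) — the merged recurrence lemma of line «SealedWallCut»

The ONE patch-transport lemma behind the two TRUE-type recurrence stubs (`stub_burgersRecurrence`,
`stub_sealedRecurrence`) of the registered line `Cruxes/RobustDefectLimitWindows/Lines/sealedwall.lean` (v5, decomp-a2c
lens 4, generation 12); the stubs themselves are derived in the companion file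
`Theorems.OverbindingBudgetPatchTransportRecurrence`.

`cleanT_transport`: a two-way `(R, ε)`-matching of patches of a `δ`-separated set (`2ε < δ`, `100ε ≤ a`) transports a
`t`-robustly clean gapped-twelve Barlow site `y` to a `t'`-robustly clean matched site `y'` whenever `t' + 2ε ≤ t` and
`a t' + 2ε ≤ a t` (`-a/50 ≤ t' ≤ t ≤ a/50`): the inner-shell count by an explicit bijection (matched points of a separated
set are unique), the window/gap inequalities pointwise (far points are beyond every radius), and the `(1/5 - t)`-closeness
of the recentred rescaled shell to the FCC/HCP kissing pattern by pushing the pattern bijection along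
`x ↦ a⁻¹ • (φ (y + a • x) - y')`, each point moving by `≤ 2ε/a` (`shellCloseTo_image`).  For a NEGATIVE target margin
`t'` (loosened sites — used to pull contact paths back) the exact `1.02a`-shell of the node predicate carries no margin,
so the lemma asks (`hthr`) that either `t' ≥ 0` or no site lie at distance in `(1.02a, 1.02a + 2ε]` from `y'`; the
companion file arranges this by taking `ε` below a third of the least gap above `1.02a` among the pair distances of the
finite source patch.  No energy, no ground state, no `μ`: uniform discreteness + matching only. [folklore techniques]
-/

namespace Summit.AtomisticToContinuum.Crystallization.Theorems.OverbindingBudgetPatchTransport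

open Literature.MathematicalPhysics.StatisticalMechanics Literature.Geometry.DiscreteGeometry Metric

/-! ## Elementary facts about matchings of separated sets -/

/-- In a uniformly discrete set every punctured closed shell `{w ∈ Y | w ≠ y ∧ dist y w ≤ ρ}` is finite (packing:
`UniformlyDiscrete.finite_inter_closedBall`). [folklore] -/
theorem finite_shell {Y : Set (EuclideanSpace ℝ (Fin 3))} (hUD : UniformlyDiscrete Y) (y : (EuclideanSpace ℝ (Fin 3))) (ρ : ℝ) :
    {w ∈ Y | w ≠ y ∧ dist y w ≤ ρ}.Finite := by
  refine (hUD.finite_inter_closedBall y ρ).subset ?_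
  intro w hw
  refine ⟨hw.1, ?_⟩
  rw [mem_closedBall, dist_comm]
  exact hw.2.2

/-- A matched pair `y ↦ y'` (base points `p ↦ q'`, error `ε`) is about as far from its base point as its partner.
[folklore] -/
theorem abs_dist_sub_dist_le {p q' y y' : (EuclideanSpace ℝ (Fin 3))} {ε : ℝ}
    (h : dist (y' - q') (y - p) ≤ ε) : |dist q' y' - dist p y| ≤ ε := by
  have h1 : dist q' y' = ‖y' - q'‖ := by rw [dist_comm, dist_eq_norm]
  have h2 : dist p y = ‖y - p‖ := by rw [dist_comm, dist_eq_norm]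
  rw [h1, h2]
  exact (abs_norm_sub_norm_le _ _).trans (by rwa [← dist_eq_norm])

/-- Two points of a `δ`-separated set matched (base points `b₁ ↦ b₂`, error `ε`, `2ε < δ`) to the same point are
equal (source side). [folklore] -/
theorem match_unique_src {Y : Set (EuclideanSpace ℝ (Fin 3))} {δ ε : ℝ} (hsep : ∀ x ∈ Y, ∀ z ∈ Y, x ≠ z → δ ≤ dist x z)
    (hεδ : 2 * ε < δ) {b₁ b₂ w₁ w₂ w' : (EuclideanSpace ℝ (Fin 3))} (hw₁ : w₁ ∈ Y) (hw₂ : w₂ ∈ Y)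
    (h₁ : dist (w' - b₂) (w₁ - b₁) ≤ ε) (h₂ : dist (w' - b₂) (w₂ - b₁) ≤ ε) : w₁ = w₂ := by
  by_contra hne
  have hδ := hsep w₁ hw₁ w₂ hw₂ hne
  have : dist w₁ w₂ ≤ ε + ε :=
    calc dist w₁ w₂ = dist (w₁ - b₁) (w₂ - b₁) := (dist_sub_right w₁ w₂ b₁).symm
      _ ≤ dist (w₁ - b₁) (w' - b₂) + dist (w' - b₂) (w₂ - b₁) := dist_triangle _ _ _
      _ ≤ ε + ε := add_le_add (by rw [dist_comm]; exact h₁) h₂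
  linarith

/-- Two points of a `δ`-separated set matched to the same point are equal (target side). [folklore] -/
theorem match_unique_tgt {Y : Set (EuclideanSpace ℝ (Fin 3))} {δ ε : ℝ} (hsep : ∀ x ∈ Y, ∀ z ∈ Y, x ≠ z → δ ≤ dist x z)
    (hεδ : 2 * ε < δ) {b₁ b₂ w w₁' w₂' : (EuclideanSpace ℝ (Fin 3))} (hw₁ : w₁' ∈ Y) (hw₂ : w₂' ∈ Y)
    (h₁ : dist (w₁' - b₂) (w - b₁) ≤ ε) (h₂ : dist (w₂' - b₂) (w - b₁) ≤ ε) : w₁' = w₂' := by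
  by_contra hne
  have hδ := hsep w₁' hw₁ w₂' hw₂ hne
  have : dist w₁' w₂' ≤ ε + ε :=
    calc dist w₁' w₂' = dist (w₁' - b₂) (w₂' - b₂) := (dist_sub_right _ _ _).symm
      _ ≤ dist (w₁' - b₂) (w - b₁) + dist (w - b₁) (w₂' - b₂) := dist_triangle _ _ _
      _ ≤ ε + ε := add_le_add h₁ (by rw [dist_comm]; exact h₂)
  linarith

/-- A matching with error `ε` distorts mutual distances by at most `2ε`. [folklore] -/
theorem dist_distort {b₁ b₂ y y' w w' : (EuclideanSpace ℝ (Fin 3))} {ε : ℝ}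
    (hy : dist (y' - b₂) (y - b₁) ≤ ε) (hw : dist (w' - b₂) (w - b₁) ≤ ε) :
    |dist y' w' - dist y w| ≤ 2 * ε := by
  have h1 : dist y' w' = dist (y' - b₂) (w' - b₂) := (dist_sub_right _ _ _).symm
  have h2 : dist y w = dist (y - b₁) (w - b₁) := (dist_sub_right _ _ _).symm
  rw [h1, h2, abs_le]
  constructor
  · linarith [dist_triangle4 (y - b₁) (y' - b₂) (w' - b₂) (w - b₁), dist_comm (y' - b₂) (y - b₁)]
  · linarith [dist_triangle4 (y' - b₂) (y - b₁) (w - b₁) (w' - b₂), dist_comm (w' - b₂) (w - b₁)]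

/-- A matched point is about as far from its base point as its partner. [folklore] -/
theorem dist_base_le {b₁ b₂ y y' : (EuclideanSpace ℝ (Fin 3))} {ε : ℝ} (hy : dist (y' - b₂) (y - b₁) ≤ ε) :
    dist y' b₂ ≤ dist y b₁ + ε := by
  have h1 := norm_le_norm_add_norm_sub' (y' - b₂) (y - b₁)
  have h2 : ‖y' - b₂ - (y - b₁)‖ = dist (y' - b₂) (y - b₁) := (dist_eq_norm _ _).symm
  rw [dist_eq_norm y' b₂, dist_eq_norm y b₁]
  linarith

/-- Recentring-rescaling `w ↦ a⁻¹ • (w - c)` is injective for `a ≠ 0`. [folklore] -/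
theorem rescale_injective {a : ℝ} (ha : a ≠ 0) (c : (EuclideanSpace ℝ (Fin 3))) : Function.Injective (fun w : (EuclideanSpace ℝ (Fin 3)) => a⁻¹ • (w - c)) := by
  intro x₁ x₂ h
  have h2 := congrArg (fun z : (EuclideanSpace ℝ (Fin 3)) => a • z) h
  simp only [smul_inv_smul₀ ha] at h2
  exact sub_left_injective h2

/-! ## Transport of `η`-closeness along an injective small motion -/

/-- If `T` is `η`-close to the pattern `P` and `g` moves each point of `T` by at most `η' - η` and is injective on
`T`, then `T.image g` is `η'`-close to `P` (compose the bijections). [folklore] -/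
theorem shellCloseTo_image {η η' : ℝ} {T P : Finset (EuclideanSpace ℝ (Fin 3))} {g : (EuclideanSpace ℝ (Fin 3)) → (EuclideanSpace ℝ (Fin 3))} (h : ShellCloseTo η T P)
    (hg : Set.InjOn g (↑T : Set (EuclideanSpace ℝ (Fin 3)))) (hmove : ∀ x ∈ T, dist (g x) x ≤ η' - η) :
    ShellCloseTo η' (T.image g) P := by
  classical
  obtain ⟨A, e, he⟩ := h
  let G : ↥T → ↥(T.image g) := fun x => ⟨g x, Finset.mem_image_of_mem g x.2⟩
  have hG : Function.Bijective G := by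
    constructor
    · intro x₁ x₂ hx
      exact Subtype.ext (hg x₁.2 x₂.2 (congrArg Subtype.val hx))
    · rintro ⟨z, hz⟩
      obtain ⟨x, hx, rfl⟩ := Finset.mem_image.1 hz
      exact ⟨⟨x, hx⟩, rfl⟩
  refine ⟨A, (Equiv.ofBijective G hG).symm.trans e, fun z => ?_⟩
  obtain ⟨x, rfl⟩ := hG.2 z
  rw [Equiv.trans_apply, Equiv.ofBijective_symm_apply_apply]
  calc dist ((G x : ↥(T.image g)) : (EuclideanSpace ℝ (Fin 3))) (e x : (EuclideanSpace ℝ (Fin 3)))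
      ≤ dist ((G x : ↥(T.image g)) : (EuclideanSpace ℝ (Fin 3))) (x : (EuclideanSpace ℝ (Fin 3))) + dist (x : (EuclideanSpace ℝ (Fin 3))) (e x : (EuclideanSpace ℝ (Fin 3))) := dist_triangle _ _ _
    _ ≤ (η' - η) + η := add_le_add (hmove x x.2) (he x)
    _ = η' := by ring

/-! ## The patch-transport lemma -/

/-- **Patch transport of robust cleanness.**  `Y` is `δ`-separated; the patches of radius `R` about the base points
`b₁`, `b₂` are two-way matched with error `ε` (`2ε < δ`, `100ε ≤ a`); `y ↦ y'` is a matched pair with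
`dist y b₁ + 2a ≤ R`; the margins satisfy `-a/50 ≤ t'`, `t ≤ a/50`, `t' + 2ε ≤ t`, `a t' + 2ε ≤ a t`; and either
`t' ≥ 0` or no site of `Y` lies at distance in `(1.02a, 1.02a + 2ε]` from `y'`.  Then `t`-robust cleanness of `y`
transports to `t'`-robust cleanness of `y'`. [folklore] -/
theorem cleanT_transport {Y : Set (EuclideanSpace ℝ (Fin 3))} {δ ε R a t t' : ℝ} {b₁ b₂ y y' : (EuclideanSpace ℝ (Fin 3))}
    (hsep : ∀ x ∈ Y, ∀ z ∈ Y, x ≠ z → δ ≤ dist x z) (hε0 : 0 ≤ ε) (hεδ : 2 * ε < δ)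
    (hex₁ : ∀ w ∈ Y, dist w b₁ ≤ R → ∃ w' ∈ Y, dist (w' - b₂) (w - b₁) ≤ ε)
    (hex₂ : ∀ w' ∈ Y, dist w' b₂ ≤ R → ∃ w ∈ Y, dist (w' - b₂) (w - b₁) ≤ ε)
    (ha : 0 < a) (hεa : 100 * ε ≤ a) (hlo : -(a / 50) ≤ t') (hhi : t ≤ a / 50)
    (htt : t' + 2 * ε ≤ t) (htta : a * t' + 2 * ε ≤ a * t)
    (hy : y ∈ Y) (hy' : y' ∈ Y) (hyy' : dist (y' - b₂) (y - b₁) ≤ ε) (hR : dist y b₁ + 2 * a ≤ R)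
    (hthr : 0 ≤ t' ∨ ∀ w' ∈ Y, w' ≠ y' → dist y' w' ≤ a * (1 + 1 / 50) ∨ a * (1 + 1 / 50) + 2 * ε < dist y' w')
    (hc : ({w ∈ Y | w ≠ y ∧ dist y w ≤ a * (1 + 1 / 50) - t}.ncard = 12 ∧ (∀ w ∈ Y, w ≠ y → a * (1 - 1 / 50) + t ≤ dist y w ∧ (dist y w ≤ a * (1 + 1 / 50) - t ∨ a * (63 / 50) + t ≤ dist y w)) ∧ (∃ T : Finset (EuclideanSpace ℝ (Fin 3)), (↑T : Set (EuclideanSpace ℝ (Fin 3))) = (fun w => a⁻¹ • (w - y)) '' {w ∈ Y | w ≠ y ∧ dist y w ≤ a * (1 + 1 / 50)} ∧ (Literature.Geometry.DiscreteGeometry.ShellCloseTo (1 / 5 - t) T Literature.Geometry.DiscreteGeometry.fccKissingPattern ∨ Literature.Geometry.DiscreteGeometry.ShellCloseTo (1 / 5 - t) T Literature.Geometry.DiscreteGeometry.hcpKissingPattern)))) :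
    ({w ∈ Y | w ≠ y' ∧ dist y' w ≤ a * (1 + 1 / 50) - t'}.ncard = 12 ∧ (∀ w ∈ Y, w ≠ y' → a * (1 - 1 / 50) + t' ≤ dist y' w ∧ (dist y' w ≤ a * (1 + 1 / 50) - t' ∨ a * (63 / 50) + t' ≤ dist y' w)) ∧ (∃ T : Finset (EuclideanSpace ℝ (Fin 3)), (↑T : Set (EuclideanSpace ℝ (Fin 3))) = (fun w => a⁻¹ • (w - y')) '' {w ∈ Y | w ≠ y' ∧ dist y' w ≤ a * (1 + 1 / 50)} ∧ (Literature.Geometry.DiscreteGeometry.ShellCloseTo (1 / 5 - t') T Literature.Geometry.DiscreteGeometry.fccKissingPattern ∨ Literature.Geometry.DiscreteGeometry.ShellCloseTo (1 / 5 - t') T Literature.Geometry.DiscreteGeometry.hcpKissingPattern))) := by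
  choose! φ hφY hφd using hex₁
  choose! ψ hψY hψd using hex₂
  obtain ⟨hc1, hc2, T, hT, hTP⟩ := hc
  have hδ : 0 < δ := by linarith
  have hUD : UniformlyDiscrete Y := ⟨δ, hδ, hsep⟩
  have hyb : dist y' b₂ ≤ dist y b₁ + ε := dist_base_le hyy'
  -- every point of the source `(1.02a - t)`-shell / target `(1.02a - t')`-shell lies in the matched patch
  have hsrcR : ∀ w ∈ Y, dist y w ≤ a * (1 + 1 / 50) - t → dist w b₁ ≤ R := by
    intro w _ hd
    have := dist_triangle w y b₁
    rw [dist_comm w y] at this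
    linarith
  have htgtR : ∀ w' ∈ Y, dist y' w' ≤ a * (1 + 1 / 50) - t' → dist w' b₂ ≤ R := by
    intro w' _ hd
    have := dist_triangle w' y' b₂
    rw [dist_comm w' y'] at this
    linarith
  -- (1) the matched image of the source shell is the target shell
  have hAφ : φ '' {w ∈ Y | w ≠ y ∧ dist y w ≤ a * (1 + 1 / 50) - t} =
      {w ∈ Y | w ≠ y' ∧ dist y' w ≤ a * (1 + 1 / 50) - t'} := by
    apply Set.Subset.antisymm
    · rintro _ ⟨w, ⟨hwY, hwy, hwd⟩, rfl⟩
      have hwR := hsrcR w hwY hwd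
      refine ⟨hφY w hwY hwR, fun heq => hwy ?_, ?_⟩
      · have h1 : dist (φ w - b₂) (y - b₁) ≤ ε := by rw [heq]; exact hyy'
        exact match_unique_src hsep hεδ hwY hy (hφd w hwY hwR) h1
      · have := (abs_le.1 (dist_distort hyy' (hφd w hwY hwR))).2
        linarith
    · rintro w' ⟨hw'Y, hw'y, hw'd⟩
      have hw'R := htgtR w' hw'Y hw'd
      have hwY := hψY w' hw'Y hw'R
      have hwm := hψd w' hw'Y hw'R
      have hwy : ψ w' ≠ y := by
        intro heq
        apply hw'y
        have h1 : dist (w' - b₂) (y - b₁) ≤ ε := by rw [← heq]; exact hwm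
        exact match_unique_tgt hsep hεδ hw'Y hy' h1 hyy'
      have hdist := (abs_le.1 (dist_distort hyy' hwm)).1
      have hdyw : dist y (ψ w') ≤ a * (1 + 1 / 50) - t := by
        rcases (hc2 (ψ w') hwY hwy).2 with h | h
        · exact h
        · exfalso; linarith
      have hwR := hsrcR (ψ w') hwY hdyw
      exact ⟨ψ w', ⟨hwY, hwy, hdyw⟩, match_unique_tgt hsep hεδ (hφY _ hwY hwR) hw'Y (hφd _ hwY hwR) hwm⟩
  have hφinj : Set.InjOn φ {w ∈ Y | w ≠ y ∧ dist y w ≤ a * (1 + 1 / 50) - t} := by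
    intro w₁ h₁ w₂ h₂ heq
    have hm₂ : dist (φ w₁ - b₂) (w₂ - b₁) ≤ ε := by rw [heq]; exact hφd w₂ h₂.1 (hsrcR w₂ h₂.1 h₂.2.2)
    exact match_unique_src hsep hεδ h₁.1 h₂.1 (hφd w₁ h₁.1 (hsrcR w₁ h₁.1 h₁.2.2)) hm₂
  -- (2) window and gap transfer pointwise
  have hc2' : ∀ w' ∈ Y, w' ≠ y' → a * (1 - 1 / 50) + t' ≤ dist y' w' ∧
      (dist y' w' ≤ a * (1 + 1 / 50) - t' ∨ a * (63 / 50) + t' ≤ dist y' w') := by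
    intro w' hw'Y hw'y
    by_cases hw'R : dist w' b₂ ≤ R
    · have hwY := hψY w' hw'Y hw'R
      have hwm := hψd w' hw'Y hw'R
      have hwy : ψ w' ≠ y := by
        intro heq
        apply hw'y
        have h1 : dist (w' - b₂) (y - b₁) ≤ ε := by rw [← heq]; exact hwm
        exact match_unique_tgt hsep hεδ hw'Y hy' h1 hyy'
      have hdist := abs_le.1 (dist_distort hyy' hwm)
      obtain ⟨h1, h2⟩ := hc2 (ψ w') hwY hwy
      refine ⟨by linarith, ?_⟩
      rcases h2 with h | h
      · left; linarith
      · right; linarith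
    · push Not at hw'R
      have := dist_triangle w' y' b₂
      rw [dist_comm w' y'] at this
      exact ⟨by linarith, Or.inr (by linarith)⟩
  -- (3) the exact `1.02a`-shells coincide with the margin shells (source and target)
  have hBA : {w ∈ Y | w ≠ y ∧ dist y w ≤ a * (1 + 1 / 50)} = {w ∈ Y | w ≠ y ∧ dist y w ≤ a * (1 + 1 / 50) - t} := by
    apply Set.eq_of_subset_of_ncard_le ?_ ?_ (finite_shell hUD y _)
    · rintro w ⟨hwY, hwy, hwd⟩
      refine ⟨hwY, hwy, ?_⟩
      rcases (hc2 w hwY hwy).2 with h | h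
      · exact h
      · exfalso; linarith
    · have h12 : T.card = 12 := card_eq_twelve_of_shellCloseTo hTP
      have hB : ((fun w => a⁻¹ • (w - y)) '' {w ∈ Y | w ≠ y ∧ dist y w ≤ a * (1 + 1 / 50)}).ncard = 12 := by
        rw [← hT, Set.ncard_coe_finset, h12]
      rw [Set.ncard_image_of_injective _ (rescale_injective ha.ne' y)] at hB
      rw [hc1, hB]
  have hB'A' : {w ∈ Y | w ≠ y' ∧ dist y' w ≤ a * (1 + 1 / 50)} =
      {w ∈ Y | w ≠ y' ∧ dist y' w ≤ a * (1 + 1 / 50) - t'} := by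
    apply Set.Subset.antisymm
    · rintro w' ⟨hw'Y, hw'y, hw'd⟩
      refine ⟨hw'Y, hw'y, ?_⟩
      rcases (hc2' w' hw'Y hw'y).2 with h | h
      · exact h
      · exfalso; linarith
    · rintro w' ⟨hw'Y, hw'y, hw'd⟩
      refine ⟨hw'Y, hw'y, ?_⟩
      rcases hthr with h0 | hgap
      · linarith
      · have hw'A : w' ∈ φ '' {w ∈ Y | w ≠ y ∧ dist y w ≤ a * (1 + 1 / 50) - t} := by
          rw [hAφ]; exact ⟨hw'Y, hw'y, hw'd⟩
        obtain ⟨w, hwA, rfl⟩ := hw'A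
        have hwB : w ∈ {w ∈ Y | w ≠ y ∧ dist y w ≤ a * (1 + 1 / 50)} := by rw [hBA]; exact hwA
        have hdist := (abs_le.1 (dist_distort hyy' (hφd w hwA.1 (hsrcR w hwA.1 hwA.2.2)))).2
        rcases hgap (φ w) hw'Y hw'y with h | h
        · exact h
        · exfalso; linarith [hwB.2.2]
  -- assemble
  refine ⟨?_, hc2', ?_⟩
  · rw [← hAφ, hφinj.ncard_image, hc1]
  · -- (4) the rescaled shell: push `T` forward along `x ↦ a⁻¹ • (φ (y + a • x) - y')`
    classical
    let g : (EuclideanSpace ℝ (Fin 3)) → (EuclideanSpace ℝ (Fin 3)) := fun x => a⁻¹ • (φ (y + a • x) - y')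
    have hback : ∀ w : (EuclideanSpace ℝ (Fin 3)), y + a • (a⁻¹ • (w - y)) = w := by
      intro w
      rw [smul_inv_smul₀ ha.ne']
      abel
    have hmemT : ∀ x ∈ T, ∃ w ∈ {w ∈ Y | w ≠ y ∧ dist y w ≤ a * (1 + 1 / 50) - t}, a⁻¹ • (w - y) = x := by
      intro x hx
      have hx' : (x : (EuclideanSpace ℝ (Fin 3))) ∈ (↑T : Set (EuclideanSpace ℝ (Fin 3))) := hx
      rw [hT, hBA] at hx'
      exact hx'
    refine ⟨T.image g, ?_, ?_⟩
    · rw [Finset.coe_image, hT, Set.image_image, hB'A', ← hAφ, Set.image_image, hBA]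
      apply Set.image_congr
      intro w _
      show a⁻¹ • (φ (y + a • (a⁻¹ • (w - y))) - y') = a⁻¹ • (φ w - y')
      rw [hback]
    · have hginj : Set.InjOn g (↑T : Set (EuclideanSpace ℝ (Fin 3))) := by
        intro x₁ hx₁ x₂ hx₂ hgx
        obtain ⟨w₁, hw₁A, rfl⟩ := hmemT x₁ hx₁
        obtain ⟨w₂, hw₂A, rfl⟩ := hmemT x₂ hx₂
        have hgx' : a⁻¹ • (φ w₁ - y') = a⁻¹ • (φ w₂ - y') := by
          have e₁ : g (a⁻¹ • (w₁ - y)) = a⁻¹ • (φ w₁ - y') := by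
            show a⁻¹ • (φ (y + a • (a⁻¹ • (w₁ - y))) - y') = _; rw [hback]
          have e₂ : g (a⁻¹ • (w₂ - y)) = a⁻¹ • (φ w₂ - y') := by
            show a⁻¹ • (φ (y + a • (a⁻¹ • (w₂ - y))) - y') = _; rw [hback]
          rw [← e₁, ← e₂]; exact hgx
        have hφeq : φ w₁ = φ w₂ := rescale_injective ha.ne' y' hgx'
        rw [hφinj hw₁A hw₂A hφeq]
      have hmove : ∀ x ∈ T, dist (g x) x ≤ (1 / 5 - t') - (1 / 5 - t) := by
        intro x hx
        obtain ⟨w, hwA, rfl⟩ := hmemT x hx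
        have hwR := hsrcR w hwA.1 hwA.2.2
        have e₁ : g (a⁻¹ • (w - y)) = a⁻¹ • (φ w - y') := by
          show a⁻¹ • (φ (y + a • (a⁻¹ • (w - y))) - y') = _; rw [hback]
        rw [e₁, dist_smul₀, Real.norm_eq_abs, abs_of_pos (inv_pos.2 ha)]
        have hd : dist (φ w - y') (w - y) ≤ 2 * ε := by
          rw [dist_eq_norm]
          have e2 : φ w - y' - (w - y) = (φ w - b₂ - (w - b₁)) - (y' - b₂ - (y - b₁)) := by abel
          rw [e2]
          calc ‖(φ w - b₂ - (w - b₁)) - (y' - b₂ - (y - b₁))‖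
              ≤ ‖φ w - b₂ - (w - b₁)‖ + ‖y' - b₂ - (y - b₁)‖ := norm_sub_le _ _
            _ ≤ ε + ε := by
                rw [← dist_eq_norm, ← dist_eq_norm]; exact add_le_add (hφd w hwA.1 hwR) hyy'
            _ = 2 * ε := by ring
        have hgoal : a⁻¹ * dist (φ w - y') (w - y) ≤ a⁻¹ * (2 * ε) :=
          mul_le_mul_of_nonneg_left hd (inv_nonneg.2 ha.le)
        have hkey : a⁻¹ * (2 * ε) ≤ t - t' := by
          rw [inv_mul_le_iff₀ ha]
          linarith
        linarith
      rcases hTP with hP | hP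
      · exact Or.inl (shellCloseTo_image hP hginj hmove)
      · exact Or.inr (shellCloseTo_image hP hginj hmove)

end Summit.AtomisticToContinuum.Crystallization.Theorems.OverbindingBudgetPatchTransport
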